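import Literature.MathematicalPhysics.QuantumFieldTheory.O2ChargedSectorsTail
import Literature.MathematicalPhysics.QuantumFieldTheory.O2ChargedSectorsRules
import HarnessLib

/-!
# The `O(2)` scan point-certificate schema with every tail in closed form

Closing file of the `O(2)` scan rung (`O2ScanObligations` → sector files `O2NeutralSectors*`,
`O2ChargedSectors*`, `O2ChargeFour*`, `O2ChargeTwoEven*`, `O2ChargeOne*`): the KERNEL CONTRACT of an
`O(2)` point certificate in the sense of Chester–Landry–Liu–Poland–Simmons-Duffin–Su–Vichi,
*Carving out OPE space and precise O(2) model critical exponents*, JHEP 06 (2020) 142, §3.1/§3.3: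
ONE scan functional `F` (nodes `(z_m, z̄_m)` in the open square and `22`-component weights) at ONE
external point `D = (Δ_s, Δ_φ, Δ_t)`, against the spectrum assumptions `A` (§2.2), with a head
threshold `E₀ > 1`, an apex threshold `E_T` and a twist margin `τ ≤ 1`.

The obligation list `O2Obligations F.toFunctional A D E₀` (22 items; seven of them — the TAILS
`Δ ≥ E₀` of the sectors `0⁺, 0⁻, 1, 2⁺, 2⁻, 3, 4` — are infinite families over every spin) follows from

* (N) ONE number `> 0` (`O2ScanObligations.unitPos_toFunctional_iff`);
* the LIGHT rows below `E₀` and the two exactly placed operators (stress tensor `(2, 3)` in `0⁺`,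
  current `(1, 2)` in `0⁻`) — HYPOTHESES here, item by item as in the list; §1 reduces each of them to
  finitely many `(ℓ, Δ-cell)` obligations (`scalarRows_of_cells`, `spinningRows_of_cells`,
  `spinningRows_of_lt`), which the cell rules of the sector files discharge
  (`pos0p/pos0m_on_cell_Ico_of_corners`, `pos3/pos2m/pos4_on_cell_Ico(_of_corners)`,
  `pos2p/pos1_on_cell_Ico`, and the `…_on_boundCell_…` rules at the unitarity bound);
* the seven TAILS by the heavy-range rules of the sector files (`pos0p_heavy`, `pos0m_heavy`,
  `pos1_heavy`, `pos2p_heavy`, `pos2m_heavy`, `pos3_heavy`, `pos4_heavy`): rule (M) — the sector's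
  kernel term test at every `(j, E)` with `E₀ ≤ E < E_T`, `j + τ ≤ E` (finitely many boxes, §1
  `termwise_of_boxes` with the `…_on_box` rules) — and rule (T) — the test at every `E ≥ E_T`, `j ≤ E`,
  which in the dominated node configuration (apex `a`, ratios `q^d, q^r`) is decided by finitely many
  CLOSED-FORM apex numbers: eight sign–radius vertex matrices for `0⁺`
  (`termMatrix0p_posSemidef_of_apex`), three numbers each for `0⁻`, `1`, `2⁺`
  (`termMatrix0m_posSemidef_of_apex`, `kernelTest1_of_apex`, `kernelTest2p_of_apex`) and one apex
  inequality each for `2⁻`, `3`, `4` (`twTerm_nonneg_of_apex`, `sector4Term_nonneg_of_apex`).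

Main statements: `o2Obligations_of_termwise` (§2: tails from termwise (M)/(T) hypotheses),
`O2PointRules` and `O2PointRules.obligations` (§3: the schema with (T) in closed form), and
`boxExcluded_of_o2PointRules` (§4: one list of functionals whose point rules hold at every point of a box
`Q`, enclosures of the external forms and four certified cover trees exclude `Q`, through
`O2ScanObligations.boxExcluded_of_uniformObligations`).  Every infinite family of the source's
semidefinite program (§3.1 bullet list with §2.2) is thereby reduced to finitely many decidable
inequalities between the certificate's own numbers plus the finitely many light cells.
No table, no number, no `sorry`.

HONEST LIMITS.  Nothing here evaluates a conformal block or checks a number: the light rows, the (M)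
term tests and the apex inequalities are hypotheses, to be discharged by a verifier from certified
enclosures (the `ConformalBootstrap3D` layer).  Which `E₀, E_T, τ, κ` and which node configuration make
them true for a given functional is not claimed.  RECORD of the engines lane (PLANNING ONLY for the
`O(2)` client path); no published number is touched.

Sources: arXiv:1912.03324 §2.2, §3.1, §3.3 (`ChesterEtAl2020`); F. Kos, D. Poland, D. Simmons-Duffin,
JHEP 06 (2014) 091, §3.3 eq. (3.16), §4 eqs. (4.2)–(4.3) (`KosPolandSimmonsduffin2014`); M. Hogervorst,
S. Rychkov, Phys. Rev. D 87 (2013) 106004, §3 eqs. (3.6), (3.9) (`HogervorstRychkov2013`);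
D. Pappadopulo, S. Rychkov, J. Espin, R. Rattazzi, Phys. Rev. D 86 (2012) 105043, §5
(`PappadopuloRychkovEspinRattazzi2012`).
-/

noncomputable section

namespace Literature.MathematicalPhysics.QuantumFieldTheory.O2PointSchema

open Finset Set Matrix Filter Topology
open Literature.MathematicalPhysics.QuantumFieldTheory.O2ThreeScalarCrossing
open Literature.MathematicalPhysics.QuantumFieldTheory.O2ThreeScalarSystem
open Literature.MathematicalPhysics.QuantumFieldTheory.OPESpaceCoverCertificate
open Literature.MathematicalPhysics.QuantumFieldTheory.O2OPEScanBridge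
open Literature.MathematicalPhysics.QuantumFieldTheory.O2ScanObligations
open Literature.MathematicalPhysics.QuantumFieldTheory.O2NeutralSectorsTermwise (sector4Term)
open Literature.MathematicalPhysics.QuantumFieldTheory.O2NeutralSectorsHead (termMatrix0p termMatrix0m)
open Literature.MathematicalPhysics.QuantumFieldTheory.O2NeutralSectorsTail (pos0p_heavy pos0m_heavy
  termMatrix0p_posSemidef_of_apex termMatrix0m_posSemidef_of_apex apexLo0p apexRad0p apexRadTW cw0m dw0m
  lab0m)
open Literature.MathematicalPhysics.QuantumFieldTheory.O2ChargedSectorsTermwise (dom3Term dom2mTerm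
  cWeight3 dWeight3 cWeight2m dWeight2m)
open Literature.MathematicalPhysics.QuantumFieldTheory.O2ChargedSectorsRules (pos3_heavy pos2m_heavy
  twTerm twTerm_nonneg_of_apex dom3Term_eq_twTerm dom2mTerm_eq_twTerm)
open Literature.MathematicalPhysics.QuantumFieldTheory.O2ChargeFourRules (pos4_heavy
  sector4Term_nonneg_of_apex cWeight4 dWeight4)
open Literature.MathematicalPhysics.QuantumFieldTheory.O2ChargeOneTermwise (cWeightX1 dWeightX1
  cWeightY1 dWeightY1)
open Literature.MathematicalPhysics.QuantumFieldTheory.O2ChargedSectorsTail (kernelTest2p kernelTest1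
  pos2p_heavy pos1_heavy kernelTest2p_of_apex kernelTest1_of_apex apexLoTW apexAbsTW cwP dwP cwQ dwQ
  expoQ cwW1 expoW1)
open Literature.Analysis.ValidatedNumerics.ParametricIntervalPosSemidef (signRadMatrix)
open ConformalBootstrap3D (unitarityBound3D exists_Ico_of_breakpoints)

/-! ## 1. Finite reductions: light rows from cell lists, (M) from box tables -/

/-- **A covered range from cells**: half-open cells `[t_i, t_{i+1})`, `i < m`, with `t_0 ≤ lo` and
`hi ≤ t_m`, each carrying `P`, cover every `Δ ∈ [lo, hi)` (by `ConformalBootstrap3D.exists_Ico_of_breakpoints`). Elementary.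
[cite: KosPolandSimmonsduffin2014, §3.3 eq. (3.16)] -/
theorem forall_of_cells (P : ℝ → Prop) (t : ℕ → ℝ) (m : ℕ) {lo hi : ℝ} (hlo : t 0 ≤ lo)
    (hhi : hi ≤ t m) (hcell : ∀ i < m, ∀ Δ ∈ Ico (t i) (t (i + 1)), P Δ) :
    ∀ Δ : ℝ, lo ≤ Δ → Δ < hi → P Δ := by
  intro Δ h1 h2
  obtain ⟨i, him, hi⟩ := exists_Ico_of_breakpoints t m (hlo.trans h1) (lt_of_lt_of_le h2 hhi)
  exact hcell i him Δ hi

/-- **A scalar item from a cell list** (`scalar_0p`, `scalar_1`, `scalar_2p`, `scalar_3`, `scalar_4` of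
`O2Obligations`): cells covering `[max(Δ_X, 1/2), E₀)` give the sector's light scalars above its
threshold `Δ_X`. [cite: ChesterEtAl2020, §3.1 (functional conditions), §2.2 (assumptions about the spectrum)] -/
theorem scalarRows_of_cells (P : ℝ → Prop) {gap E₀ : ℝ} (t : ℕ → ℝ) (m : ℕ)
    (hlo : t 0 ≤ max gap (1 / 2)) (hhi : E₀ ≤ t m)
    (hcell : ∀ i < m, ∀ Δ ∈ Ico (t i) (t (i + 1)), P Δ) :
    ∀ Δ : ℝ, 1 / 2 ≤ Δ → gap ≤ Δ → Δ < E₀ → P Δ :=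
  fun Δ hb hg hE => forall_of_cells P t m le_rfl hhi hcell Δ (hlo.trans (max_le hg hb)) hE

/-- **A spinning item of one spin from a cell list** (`spinning_X` of `O2Obligations` at the spin `ℓ`,
side condition `S` = the item's parity / `ℓ ≠ 0` clause): cells covering `[ℓ + 1 + δ_τ, E₀)` give the
light rows of that spin from the twist threshold. [cite: ChesterEtAl2020, §3.1 (functional conditions), §2.2 (assumptions about the spectrum)] -/
theorem spinningRows_of_cells (P : ℝ → Prop) {ℓ : ℕ} {δτ E₀ : ℝ} (t : ℕ → ℝ) (m : ℕ)
    (hlo : t 0 ≤ (ℓ : ℝ) + 1 + δτ) (hhi : E₀ ≤ t m)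
    (hcell : ∀ i < m, ∀ Δ ∈ Ico (t i) (t (i + 1)), P Δ) :
    ∀ Δ : ℝ, (ℓ : ℝ) + 1 ≤ Δ → (ℓ : ℝ) + 1 + δτ ≤ Δ → Δ < E₀ → P Δ :=
  fun Δ _ hτ hE => forall_of_cells P t m le_rfl hhi hcell Δ (hlo.trans hτ) hE

/-- **Finitely many spins carry light rows**: a spinning item is void at every spin `ℓ` with
`E₀ ≤ ℓ + 1` (its range `ℓ + 1 ≤ Δ < E₀` is empty), so the spins `ℓ < L` with `E₀ ≤ L + 1` suffice
(`S` = the item's side condition on `ℓ`). [cite: ChesterEtAl2020, §3.1 (functional conditions)] -/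
theorem spinningRows_of_lt (S : ℕ → Prop) (P : ℕ → ℝ → Prop) {δτ E₀ : ℝ} (L : ℕ)
    (hL : E₀ ≤ (L : ℝ) + 1)
    (h : ∀ ℓ < L, S ℓ → ∀ Δ : ℝ, (ℓ : ℝ) + 1 ≤ Δ → (ℓ : ℝ) + 1 + δτ ≤ Δ → Δ < E₀ → P ℓ Δ) :
    ∀ ℓ : ℕ, S ℓ → ∀ Δ : ℝ, (ℓ : ℝ) + 1 ≤ Δ → (ℓ : ℝ) + 1 + δτ ≤ Δ → Δ < E₀ → P ℓ Δ := by
  intro ℓ hS Δ h1 hτ hE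
  by_cases hℓ : ℓ < L
  · exact h ℓ hℓ hS Δ h1 hτ hE
  · exfalso
    have hL' : (L : ℝ) ≤ ℓ := by exact_mod_cast not_lt.1 hℓ
    linarith

/-- **Rule (M) from a box table**: for each `j` with `j + τ < E_T` a chain of boxes
`[e_{j,0}, e_{j,1}], …, [e_{j,M_j−1}, e_{j,M_j}]` with `e_{j,0} ≤ max(E₀, j + τ)` and `E_T ≤ e_{j,M_j}`, the
term test holding on each box (the `…_on_box` rules: corner numbers), gives the test at every `(j, E)`
with `E₀ ≤ E < E_T`, `j + τ ≤ E`; for `j + τ ≥ E_T` there is no such `E`.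
[cite: KosPolandSimmonsduffin2014, §3.3 eq. (3.16), §4 eqs. (4.2)–(4.3)] -/
theorem termwise_of_boxes (P : ℝ → ℕ → Prop) {E₀ ET τ : ℝ} (e : ℕ → ℕ → ℝ) (Mj : ℕ → ℕ)
    (he : ∀ j : ℕ, (j : ℝ) + τ < ET → e j 0 ≤ max E₀ ((j : ℝ) + τ) ∧ ET ≤ e j (Mj j))
    (hbox : ∀ j : ℕ, (j : ℝ) + τ < ET → ∀ m < Mj j, ∀ E ∈ Icc (e j m) (e j (m + 1)), P E j) :
    ∀ (j : ℕ) (E : ℝ), E₀ ≤ E → E < ET → (j : ℝ) + τ ≤ E → P E j := by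
  intro j E h0 hT hj
  have hjT : (j : ℝ) + τ < ET := lt_of_le_of_lt hj hT
  obtain ⟨he0, heM⟩ := he j hjT
  obtain ⟨m, hm, hEm⟩ := exists_Ico_of_breakpoints (e j) (Mj j) (he0.trans (max_le h0 hj))
    (lt_of_lt_of_le hT heM)
  exact hbox j hjT m hm E (Ico_subset_Icc_self hEm)

/-! ## 2. The point schema with termwise tails -/

/-- **Obligations from light rows and termwise tails.**  For a scan functional `F` at the point `D`:
the unit number `> 0`, the light rows and the two exactly placed operators as listed, and for each of
the seven sectors the kernel term test at every `(j, E)` of the middle range `E₀ ≤ E < E_T`, `j + τ ≤ E`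
(M) and of the apex range `E ≥ E_T`, `j ≤ E` (T), give the whole list `O2Obligations F.toFunctional A D E₀`
(`E₀ > 1`, `τ ≤ 1`, `τ ≤ E₀`; sector `1` with its diagonal-budget parameter `κ > 0`).  The tails come
from the heavy-range rules of the sector files, which cover every spin (the parity clauses of the
list are not used). [cite: ChesterEtAl2020, §3.1 (functional conditions), §2.2 (assumptions about the spectrum)]
[cite: KosPolandSimmonsduffin2014, §3.3 eq. (3.16), §4 eqs. (4.2)–(4.3)] -/
theorem o2Obligations_of_termwise (F : ScanFunctional) (A : O2Gaps) (D : Dims) {κ E₀ ET τ : ℝ}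
    (hκ : 0 < κ) (hτ1 : τ ≤ 1) (hτ0 : τ ≤ E₀) (hE₀ : 1 < E₀)
    -- (N)
    (hN : 0 < ![(1 : ℝ), 1, 1] ⬝ᵥ ((∑ m, ∑ r, F.w m r • V0p D unitBlocks (F.u m) (F.v m) r) *ᵥ
      ![(1 : ℝ), 1, 1]))
    -- light rows and exactly placed operators
    (h0ps : ∀ Δ : ℝ, 1 / 2 ≤ Δ → A.Δ0 ≤ Δ → Δ < E₀ → Pos0p F.toFunctional D Δ 0)
    (h0pT : Pos0p F.toFunctional D 3 2)
    (h0pℓ : ∀ ℓ : ℕ, Even ℓ → ℓ ≠ 0 → ∀ Δ : ℝ, (ℓ : ℝ) + 1 ≤ Δ → (ℓ : ℝ) + 1 + A.δτ ≤ Δ →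
      Δ < E₀ → Pos0p F.toFunctional D Δ ℓ)
    (h0mJ : Pos0m F.toFunctional D 2 1)
    (h0mℓ : ∀ ℓ : ℕ, Odd ℓ → ∀ Δ : ℝ, (ℓ : ℝ) + 1 ≤ Δ → (ℓ : ℝ) + 1 + A.δτ ≤ Δ → Δ < E₀ →
      Pos0m F.toFunctional D Δ ℓ)
    (h1s : ∀ Δ : ℝ, 1 / 2 ≤ Δ → A.Δ1 ≤ Δ → Δ < E₀ → Pos1 F.toFunctional D Δ 0)
    (h1ℓ : ∀ ℓ : ℕ, ℓ ≠ 0 → ∀ Δ : ℝ, (ℓ : ℝ) + 1 ≤ Δ → (ℓ : ℝ) + 1 + A.δτ ≤ Δ → Δ < E₀ →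
      Pos1 F.toFunctional D Δ ℓ)
    (h2ps : ∀ Δ : ℝ, 1 / 2 ≤ Δ → A.Δ2 ≤ Δ → Δ < E₀ → Pos2p F.toFunctional D Δ 0)
    (h2pℓ : ∀ ℓ : ℕ, Even ℓ → ℓ ≠ 0 → ∀ Δ : ℝ, (ℓ : ℝ) + 1 ≤ Δ → (ℓ : ℝ) + 1 + A.δτ ≤ Δ →
      Δ < E₀ → Pos2p F.toFunctional D Δ ℓ)
    (h2mℓ : ∀ ℓ : ℕ, Odd ℓ → ∀ Δ : ℝ, (ℓ : ℝ) + 1 ≤ Δ → (ℓ : ℝ) + 1 + A.δτ ≤ Δ → Δ < E₀ →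
      Pos2m F.toFunctional D Δ ℓ)
    (h3s : ∀ Δ : ℝ, 1 / 2 ≤ Δ → A.Δ3 ≤ Δ → Δ < E₀ → Pos3 F.toFunctional D Δ 0)
    (h3ℓ : ∀ ℓ : ℕ, ℓ ≠ 0 → ∀ Δ : ℝ, (ℓ : ℝ) + 1 ≤ Δ → (ℓ : ℝ) + 1 + A.δτ ≤ Δ → Δ < E₀ →
      Pos3 F.toFunctional D Δ ℓ)
    (h4s : ∀ Δ : ℝ, 1 / 2 ≤ Δ → A.Δ4 ≤ Δ → Δ < E₀ → Pos4 F.toFunctional D Δ 0)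
    (h4ℓ : ∀ ℓ : ℕ, Even ℓ → ℓ ≠ 0 → ∀ Δ : ℝ, (ℓ : ℝ) + 1 ≤ Δ → (ℓ : ℝ) + 1 + A.δτ ≤ Δ →
      Δ < E₀ → Pos4 F.toFunctional D Δ ℓ)
    -- (M): the middle range E₀ ≤ E < E_T
    (hM0p : ∀ (j : ℕ) (E : ℝ), E₀ ≤ E → E < ET → (j : ℝ) + τ ≤ E → (termMatrix0p F D E j).PosSemidef)
    (hM0m : ∀ (j : ℕ) (E : ℝ), E₀ ≤ E → E < ET → (j : ℝ) + τ ≤ E → (termMatrix0m F D E j).PosSemidef)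
    (hM1 : ∀ (j : ℕ) (E : ℝ), E₀ ≤ E → E < ET → (j : ℝ) + τ ≤ E → kernelTest1 F D κ E j)
    (hM2p : ∀ (j : ℕ) (E : ℝ), E₀ ≤ E → E < ET → (j : ℝ) + τ ≤ E → kernelTest2p F D E j)
    (hM2m : ∀ (j : ℕ) (E : ℝ), E₀ ≤ E → E < ET → (j : ℝ) + τ ≤ E → 0 ≤ dom2mTerm F D E j)
    (hM3 : ∀ (j : ℕ) (E : ℝ), E₀ ≤ E → E < ET → (j : ℝ) + τ ≤ E → 0 ≤ dom3Term F D E j)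
    (hM4 : ∀ (j : ℕ) (E : ℝ), E₀ ≤ E → E < ET → (j : ℝ) + τ ≤ E → 0 ≤ sector4Term F D E j)
    -- (T): the apex range E ≥ E_T
    (hT0p : ∀ E : ℝ, ET ≤ E → ∀ j : ℕ, (j : ℝ) ≤ E → (termMatrix0p F D E j).PosSemidef)
    (hT0m : ∀ E : ℝ, ET ≤ E → ∀ j : ℕ, (j : ℝ) ≤ E → (termMatrix0m F D E j).PosSemidef)
    (hT1 : ∀ E : ℝ, ET ≤ E → ∀ j : ℕ, (j : ℝ) ≤ E → kernelTest1 F D κ E j)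
    (hT2p : ∀ E : ℝ, ET ≤ E → ∀ j : ℕ, (j : ℝ) ≤ E → kernelTest2p F D E j)
    (hT2m : ∀ E : ℝ, ET ≤ E → ∀ j : ℕ, (j : ℝ) ≤ E → 0 ≤ dom2mTerm F D E j)
    (hT3 : ∀ E : ℝ, ET ≤ E → ∀ j : ℕ, (j : ℝ) ≤ E → 0 ≤ dom3Term F D E j)
    (hT4 : ∀ E : ℝ, ET ≤ E → ∀ j : ℕ, (j : ℝ) ≤ E → 0 ≤ sector4Term F D E j) :
    O2Obligations F.toFunctional A D E₀ :=
  { unit_pos := (unitPos_toFunctional_iff F D).2 hN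
    scalar_0p := h0ps
    stress_0p := h0pT
    spinning_0p := h0pℓ
    tail_0p := fun ℓ _ Δ hb h0 => pos0p_heavy F D hτ1 hτ0 hM0p hT0p ℓ Δ hb h0
    current_0m := h0mJ
    spinning_0m := h0mℓ
    tail_0m := fun ℓ _ Δ hb h0 => pos0m_heavy F D hτ1 hτ0 hM0m hT0m ℓ Δ hb h0
    scalar_1 := h1s
    spinning_1 := h1ℓ
    tail_1 := pos1_heavy F D hκ hτ1 hτ0 hE₀ hM1 hT1
    scalar_2p := h2ps
    spinning_2p := h2pℓ
    tail_2p := fun ℓ _ Δ hb h0 => pos2p_heavy F D hτ1 hτ0 hE₀ hM2p hT2p ℓ Δ hb h0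
    spinning_2m := h2mℓ
    tail_2m := fun ℓ _ Δ hb h0 => pos2m_heavy F D hτ1 hτ0 hE₀ hM2m hT2m ℓ Δ hb h0
    scalar_3 := h3s
    spinning_3 := h3ℓ
    tail_3 := pos3_heavy F D hτ1 hτ0 hE₀ hM3 hT3
    scalar_4 := h4s
    spinning_4 := h4ℓ
    tail_4 := fun ℓ _ Δ hb h0 => pos4_heavy F D hτ1 hτ0 hM4 hT4 ℓ Δ hb h0 }

/-! ## 3. The schema: rule (T) by closed-form apex numbers -/

/-- **The `O(2)` point rules** — the kernel contract of a point certificate for ONE scan functional `F`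
at ONE point `D` against `A`: thresholds `E₀` (head), `E_T` (apex), twist margin `τ`, the sector-`1`
budget parameter `κ`, and a dominated node configuration (apex `a`, ratios `q^d_m, q^r_m ∈ (0, 1]`,
`z̄_m ≤ z_m`).  Items: (N) the unit number; the fourteen light / exactly-placed items of
`O2Obligations` verbatim; rule (M) termwise on the middle range for the seven sectors; rule (T) as
closed-form apex inequalities — eight sign–radius vertex matrices (`0⁺`), three numbers each
(`0⁻`, `1`, `2⁺`), one inequality each (`2⁻`, `3`, `4`).
[cite: ChesterEtAl2020, §3.1 (functional conditions), §2.2 (assumptions about the spectrum)]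
[cite: KosPolandSimmonsduffin2014, §3.3 eq. (3.16), §4 eqs. (4.2)–(4.3)] [cite: HogervorstRychkov2013, §3 eq. (3.6)] -/
structure O2PointRules (F : ScanFunctional) (A : O2Gaps) (D : Dims) (κ E₀ ET τ : ℝ) (a : Fin F.M)
    (qd qr : Fin F.M → ℝ) : Prop where
  /-- `κ > 0`. -/
  κ_pos : 0 < κ
  /-- `τ ≤ 1`. -/
  τ_le_one : τ ≤ 1
  /-- `τ ≤ E₀`. -/
  τ_le : τ ≤ E₀
  /-- `1 < E₀`. -/
  one_lt : 1 < E₀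
  /-- node ordering `z̄_m ≤ z_m`. -/
  ord : ∀ m, F.zb m ≤ F.z m
  /-- `q^d_m ∈ (0, 1]`. -/
  qd_mem : ∀ m, 0 < qd m ∧ qd m ≤ 1
  /-- `q^r_m ∈ (0, 1]`. -/
  qr_mem : ∀ m, 0 < qr m ∧ qr m ≤ 1
  /-- direct-channel domination by the apex. -/
  domd : ∀ m, F.z m * F.zb m ≤ qd m ^ 2 * (F.z a * F.zb a) ∧ F.z m ≤ qd m * F.z a
  /-- crossed-channel domination by the apex. -/
  domr : ∀ m, (1 - F.z m) * (1 - F.zb m) ≤ qr m ^ 2 * (F.z a * F.zb a) ∧ 1 - F.zb m ≤ qr m * F.z a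
  /-- (N) the unit number. -/
  unit : 0 < ![(1 : ℝ), 1, 1] ⬝ᵥ ((∑ m, ∑ r, F.w m r • V0p D unitBlocks (F.u m) (F.v m) r) *ᵥ
    ![(1 : ℝ), 1, 1])
  /-- (0⁺, scalars). -/
  scalar_0p : ∀ Δ : ℝ, 1 / 2 ≤ Δ → A.Δ0 ≤ Δ → Δ < E₀ → Pos0p F.toFunctional D Δ 0
  /-- (0⁺, T). -/
  stress_0p : Pos0p F.toFunctional D 3 2
  /-- (0⁺, spinning). -/
  spinning_0p : ∀ ℓ : ℕ, Even ℓ → ℓ ≠ 0 → ∀ Δ : ℝ, (ℓ : ℝ) + 1 ≤ Δ → (ℓ : ℝ) + 1 + A.δτ ≤ Δ →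
    Δ < E₀ → Pos0p F.toFunctional D Δ ℓ
  /-- (0⁻, J). -/
  current_0m : Pos0m F.toFunctional D 2 1
  /-- (0⁻, spinning). -/
  spinning_0m : ∀ ℓ : ℕ, Odd ℓ → ∀ Δ : ℝ, (ℓ : ℝ) + 1 ≤ Δ → (ℓ : ℝ) + 1 + A.δτ ≤ Δ → Δ < E₀ →
    Pos0m F.toFunctional D Δ ℓ
  /-- (1, scalars). -/
  scalar_1 : ∀ Δ : ℝ, 1 / 2 ≤ Δ → A.Δ1 ≤ Δ → Δ < E₀ → Pos1 F.toFunctional D Δ 0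
  /-- (1, spinning). -/
  spinning_1 : ∀ ℓ : ℕ, ℓ ≠ 0 → ∀ Δ : ℝ, (ℓ : ℝ) + 1 ≤ Δ → (ℓ : ℝ) + 1 + A.δτ ≤ Δ → Δ < E₀ →
    Pos1 F.toFunctional D Δ ℓ
  /-- (2⁺, scalars). -/
  scalar_2p : ∀ Δ : ℝ, 1 / 2 ≤ Δ → A.Δ2 ≤ Δ → Δ < E₀ → Pos2p F.toFunctional D Δ 0
  /-- (2⁺, spinning). -/
  spinning_2p : ∀ ℓ : ℕ, Even ℓ → ℓ ≠ 0 → ∀ Δ : ℝ, (ℓ : ℝ) + 1 ≤ Δ → (ℓ : ℝ) + 1 + A.δτ ≤ Δ →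
    Δ < E₀ → Pos2p F.toFunctional D Δ ℓ
  /-- (2⁻, spinning). -/
  spinning_2m : ∀ ℓ : ℕ, Odd ℓ → ∀ Δ : ℝ, (ℓ : ℝ) + 1 ≤ Δ → (ℓ : ℝ) + 1 + A.δτ ≤ Δ → Δ < E₀ →
    Pos2m F.toFunctional D Δ ℓ
  /-- (3, scalars). -/
  scalar_3 : ∀ Δ : ℝ, 1 / 2 ≤ Δ → A.Δ3 ≤ Δ → Δ < E₀ → Pos3 F.toFunctional D Δ 0
  /-- (3, spinning). -/
  spinning_3 : ∀ ℓ : ℕ, ℓ ≠ 0 → ∀ Δ : ℝ, (ℓ : ℝ) + 1 ≤ Δ → (ℓ : ℝ) + 1 + A.δτ ≤ Δ → Δ < E₀ →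
    Pos3 F.toFunctional D Δ ℓ
  /-- (4, scalars). -/
  scalar_4 : ∀ Δ : ℝ, 1 / 2 ≤ Δ → A.Δ4 ≤ Δ → Δ < E₀ → Pos4 F.toFunctional D Δ 0
  /-- (4, spinning). -/
  spinning_4 : ∀ ℓ : ℕ, Even ℓ → ℓ ≠ 0 → ∀ Δ : ℝ, (ℓ : ℝ) + 1 ≤ Δ → (ℓ : ℝ) + 1 + A.δτ ≤ Δ →
    Δ < E₀ → Pos4 F.toFunctional D Δ ℓ
  /-- (M, 0⁺). -/
  mid_0p : ∀ (j : ℕ) (E : ℝ), E₀ ≤ E → E < ET → (j : ℝ) + τ ≤ E → (termMatrix0p F D E j).PosSemidef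
  /-- (M, 0⁻). -/
  mid_0m : ∀ (j : ℕ) (E : ℝ), E₀ ≤ E → E < ET → (j : ℝ) + τ ≤ E → (termMatrix0m F D E j).PosSemidef
  /-- (M, 1). -/
  mid_1 : ∀ (j : ℕ) (E : ℝ), E₀ ≤ E → E < ET → (j : ℝ) + τ ≤ E → kernelTest1 F D κ E j
  /-- (M, 2⁺). -/
  mid_2p : ∀ (j : ℕ) (E : ℝ), E₀ ≤ E → E < ET → (j : ℝ) + τ ≤ E → kernelTest2p F D E j
  /-- (M, 2⁻). -/
  mid_2m : ∀ (j : ℕ) (E : ℝ), E₀ ≤ E → E < ET → (j : ℝ) + τ ≤ E → 0 ≤ dom2mTerm F D E j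
  /-- (M, 3). -/
  mid_3 : ∀ (j : ℕ) (E : ℝ), E₀ ≤ E → E < ET → (j : ℝ) + τ ≤ E → 0 ≤ dom3Term F D E j
  /-- (M, 4). -/
  mid_4 : ∀ (j : ℕ) (E : ℝ), E₀ ≤ E → E < ET → (j : ℝ) + τ ≤ E → 0 ≤ sector4Term F D E j
  /-- (T, 0⁺): the eight sign–radius vertex matrices of the apex tables are PSD. -/
  apex_0p : ∀ z : Fin 3 → Bool,
    (signRadMatrix (apexLo0p F D a qd qr ET) (apexRad0p F D a qd qr ET) z).PosSemidef
  /-- (T, 0⁻): `X ≥ 0`. -/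
  apexX_0m : 0 ≤ cw0m F 0 0 a * ((1 - F.z a) * (1 - F.zb a)) ^ D.expo (lab0m 0 0) -
    apexRadTW F (cw0m F 0 0) (dw0m F 0 0) a qd qr (D.expo (lab0m 0 0)) ET
  /-- (T, 0⁻): `Y ≥ 0`. -/
  apexY_0m : 0 ≤ cw0m F 1 1 a * ((1 - F.z a) * (1 - F.zb a)) ^ D.expo (lab0m 1 1) -
    apexRadTW F (cw0m F 1 1) (dw0m F 1 1) a qd qr (D.expo (lab0m 1 1)) ET
  /-- (T, 0⁻): `Z² ≤ XY` (with the off-diagonal radius). -/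
  apexZ_0m : (|cw0m F 0 1 a * ((1 - F.z a) * (1 - F.zb a)) ^ D.expo (lab0m 0 1)| +
      apexRadTW F (cw0m F 0 1) (dw0m F 0 1) a qd qr (D.expo (lab0m 0 1)) ET) ^ 2 ≤
    (cw0m F 0 0 a * ((1 - F.z a) * (1 - F.zb a)) ^ D.expo (lab0m 0 0) -
        apexRadTW F (cw0m F 0 0) (dw0m F 0 0) a qd qr (D.expo (lab0m 0 0)) ET) *
      (cw0m F 1 1 a * ((1 - F.z a) * (1 - F.zb a)) ^ D.expo (lab0m 1 1) -
        apexRadTW F (cw0m F 1 1) (dw0m F 1 1) a qd qr (D.expo (lab0m 1 1)) ET)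
  /-- (T, 1): `X ≥ 0`. -/
  apexX_1 : 0 ≤ apexLoTW F (cWeightX1 F κ) (dWeightX1 F κ) a qd qr (D.expo .sφφs) ET
  /-- (T, 1): `Y ≥ 0`. -/
  apexY_1 : 0 ≤ apexLoTW F (cWeightY1 F κ) (dWeightY1 F κ) a qd qr (D.expo .φttφ) ET
  /-- (T, 1): `Z² ≤ 4XY`. -/
  apexZ_1 : apexAbsTW F (cwW1 F) (cwW1 F) a qd qr (expoW1 D) ET ^ 2 ≤
    4 * apexLoTW F (cWeightX1 F κ) (dWeightX1 F κ) a qd qr (D.expo .sφφs) ET *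
      apexLoTW F (cWeightY1 F κ) (dWeightY1 F κ) a qd qr (D.expo .φttφ) ET
  /-- (T, 2⁺): `X ≥ 0`. -/
  apexX_2p : 0 ≤ apexLoTW F (cwP F) (dwP F) a qd qr (D.expo .φφφφ) ET
  /-- (T, 2⁺): `Y ≥ 0`. -/
  apexY_2p : 0 ≤ apexLoTW F (cWeight2m F) (dWeight2m F) a qd qr (D.expo .stts) ET
  /-- (T, 2⁺): `Z² ≤ 4XY`. -/
  apexZ_2p : apexAbsTW F (cwQ F) (dwQ F) a qd qr (expoQ D) ET ^ 2 ≤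
    4 * apexLoTW F (cwP F) (dwP F) a qd qr (D.expo .φφφφ) ET *
      apexLoTW F (cWeight2m F) (dWeight2m F) a qd qr (D.expo .stts) ET
  /-- (T, 2⁻): one apex inequality. -/
  apex_2m : 0 ≤ cWeight2m F a * ((1 - F.z a) * (1 - F.zb a)) ^ D.expo .stts -
    apexRadTW F (cWeight2m F) (dWeight2m F) a qd qr (D.expo .stts) ET
  /-- (T, 3): one apex inequality. -/
  apex_3 : 0 ≤ cWeight3 F a * ((1 - F.z a) * (1 - F.zb a)) ^ D.expo .φttφ -
    apexRadTW F (cWeight3 F) (dWeight3 F) a qd qr (D.expo .φttφ) ET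
  /-- (T, 4): one apex inequality. -/
  apex_4 : 0 ≤ cWeight4 F a * ((1 - F.z a) * (1 - F.zb a)) ^ D.expo .tttt -
    apexRadTW F (cWeight4 F) (dWeight4 F) a qd qr (D.expo .tttt) ET

namespace O2PointRules

variable {F : ScanFunctional} {A : O2Gaps} {D : Dims} {κ E₀ ET τ : ℝ} {a : Fin F.M}
  {qd qr : Fin F.M → ℝ}

/-- Rule (T) for `2⁻` from its apex inequality. [cite: HogervorstRychkov2013, §3 eq. (3.6)] -/
theorem apexRange_2m (h : O2PointRules F A D κ E₀ ET τ a qd qr) :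
    ∀ E : ℝ, ET ≤ E → ∀ j : ℕ, (j : ℝ) ≤ E → 0 ≤ dom2mTerm F D E j := by
  intro E hE j hj
  rw [dom2mTerm_eq_twTerm]
  exact twTerm_nonneg_of_apex F _ _ _ h.ord a qd qr h.qd_mem h.qr_mem h.domd h.domr h.apex_2m E hE j hj

/-- Rule (T) for `3` from its apex inequality. [cite: HogervorstRychkov2013, §3 eq. (3.6)] -/
theorem apexRange_3 (h : O2PointRules F A D κ E₀ ET τ a qd qr) :
    ∀ E : ℝ, ET ≤ E → ∀ j : ℕ, (j : ℝ) ≤ E → 0 ≤ dom3Term F D E j := by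
  intro E hE j hj
  rw [dom3Term_eq_twTerm]
  exact twTerm_nonneg_of_apex F _ _ _ h.ord a qd qr h.qd_mem h.qr_mem h.domd h.domr h.apex_3 E hE j hj

/-- **The schema**: the point rules give the obligation list, every tail in closed form.
[cite: ChesterEtAl2020, §3.1 (functional conditions), §2.2 (assumptions about the spectrum)]
[cite: KosPolandSimmonsduffin2014, §3.3 eq. (3.16), §4 eqs. (4.2)–(4.3)] -/
theorem obligations (h : O2PointRules F A D κ E₀ ET τ a qd qr) : O2Obligations F.toFunctional A D E₀ :=
  o2Obligations_of_termwise F A D h.κ_pos h.τ_le_one h.τ_le h.one_lt h.unit h.scalar_0p h.stress_0p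
    h.spinning_0p h.current_0m h.spinning_0m h.scalar_1 h.spinning_1 h.scalar_2p h.spinning_2p
    h.spinning_2m h.scalar_3 h.spinning_3 h.scalar_4 h.spinning_4 h.mid_0p h.mid_0m h.mid_1 h.mid_2p
    h.mid_2m h.mid_3 h.mid_4
    (termMatrix0p_posSemidef_of_apex F D h.ord a qd qr h.qd_mem h.qr_mem h.domd h.domr h.apex_0p)
    (termMatrix0m_posSemidef_of_apex F D h.ord a qd qr h.qd_mem h.qr_mem h.domd h.domr h.apexX_0m
      h.apexY_0m h.apexZ_0m)
    (kernelTest1_of_apex F D κ h.ord a qd qr h.qd_mem h.qr_mem h.domd h.domr h.apexX_1 h.apexY_1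
      h.apexZ_1)
    (kernelTest2p_of_apex F D h.ord a qd qr h.qd_mem h.qr_mem h.domd h.domr h.apexX_2p h.apexY_2p
      h.apexZ_2p)
    h.apexRange_2m h.apexRange_3
    (sector4Term_nonneg_of_apex F D h.ord a qd qr h.qd_mem h.qr_mem h.domd h.domr h.apex_4)

/-- The point rules give the `l`-independent half of the functional conditions.
[cite: ChesterEtAl2020, §3.1 (functional conditions)] -/
theorem isPositiveFor_zero (h : O2PointRules F A D κ E₀ ET τ a qd qr) :
    IsPositiveFor F.toFunctional A D 0 :=
  h.obligations.isPositiveFor_zero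

end O2PointRules

/-! ## 4. Box exclusion from point rules -/

/-- **Uniform certificate for a box from point rules**: ONE finite list of scan functionals whose point
rules hold at every point of `Q` (each with its own thresholds, budget parameter and node
configuration), ONE family of enclosures of their external forms valid on `Q`, FOUR certified cover
trees — then no unitary `O(2)` solution of the assumptions `A` has `(Δ_s, Δ_φ, Δ_t) ∈ Q`.
[cite: ChesterEtAl2020, §3.3 (allowed and disallowed points; Algorithm 1), §3.1 (functional conditions)] -/
theorem boxExcluded_of_o2PointRules {A : O2Gaps} {Q : Set (ℝ × ℝ × ℝ)} {ι : Type*}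
    (F : ι → ScanFunctional) (κ E₀ ET τ : ι → ℝ) (a : ∀ k, Fin (F k).M)
    (qd qr : ∀ k, Fin (F k).M → ℝ) (Blo Bhi : ι → Matrix (Fin 4) (Fin 4) ℝ)
    (T : Fin 4 → CoverTree ι 4)
    (hR : ∀ D : Dims, (D.Δs, D.Δφ, D.Δt) ∈ Q → ∀ k,
      O2PointRules (F k) A D (κ k) (E₀ k) (ET k) (τ k) (a k) (qd k) (qr k))
    (henc : ∀ D : Dims, (D.Δs, D.Δφ, D.Δt) ∈ Q → ∀ k, ExtEnclosed (F k).toFunctional D (Blo k) (Bhi k))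
    (hT : ∀ i : Fin 4, (T i).Certifies (intervalVertexTest Blo Bhi) (facetLo i) (fun _ => (1 : ℝ))) :
    BoxExcluded A Q :=
  boxExcluded_of_uniformObligations F E₀ Blo Bhi T (fun D hD k => (hR D hD k).obligations) henc hT

/-- The same under STRONGER assumptions `A'` from point rules against weaker ones (`A.Weaker A'`).
[cite: ChesterEtAl2020, §2.2 (assumptions about the spectrum), §4.1 (gap assumptions)] -/
theorem boxExcluded_of_o2PointRules_of_weaker {A A' : O2Gaps} {Q : Set (ℝ × ℝ × ℝ)} {ι : Type*}
    (hw : A.Weaker A') (F : ι → ScanFunctional) (κ E₀ ET τ : ι → ℝ) (a : ∀ k, Fin (F k).M)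
    (qd qr : ∀ k, Fin (F k).M → ℝ) (Blo Bhi : ι → Matrix (Fin 4) (Fin 4) ℝ)
    (T : Fin 4 → CoverTree ι 4)
    (hR : ∀ D : Dims, (D.Δs, D.Δφ, D.Δt) ∈ Q → ∀ k,
      O2PointRules (F k) A D (κ k) (E₀ k) (ET k) (τ k) (a k) (qd k) (qr k))
    (henc : ∀ D : Dims, (D.Δs, D.Δφ, D.Δt) ∈ Q → ∀ k, ExtEnclosed (F k).toFunctional D (Blo k) (Bhi k))
    (hT : ∀ i : Fin 4, (T i).Certifies (intervalVertexTest Blo Bhi) (facetLo i) (fun _ => (1 : ℝ))) :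
    BoxExcluded A' Q :=
  (boxExcluded_of_o2PointRules F κ E₀ ET τ a qd qr Blo Bhi T hR henc hT).of_weaker hw

end Literature.MathematicalPhysics.QuantumFieldTheory.O2PointSchema

end
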